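import Literature.MathematicalPhysics.QuantumManyBody.JelliumBoseGasDilation
import HarnessLib

/-!
# Route `BECTangentRigidity`, crux `RigidMomentumBound` (stmt-AtomisticToContinuum-13034):
# stub `stub_energyScalePotentialLe` — energy comparison under fattening of a Lipschitz
# finite-range potential

Supports (does not close) stmt-AtomisticToContinuum-13034 (soft-core side-result of the
registered line). For a real pair-potential profile `f` that is `K`-Lipschitz and vanishes on
`[R, ∞)`, put `v = ofReal ∘ f` and let `v_s = scalePotential s v = (r ↦ s⁻² v(r/s))` be its
dilation by `s ≥ 1`. Then for every admissible trial state `Φ`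

`𝓔_{v_s}[Φ] ≤ 𝓔_v[Φ] + K s R (1 - s⁻¹) · ∫ P_{sR}(X) |Φ(X)|² dX`,

where `P_{sR}(X) = #{i < j : |xᵢ - xⱼ| ≤ sR}` counts the pairs within the dilated range.

Proof: the kinetic parts agree; pointwise, `s⁻² ≤ 1` and, for a pair at distance `r`,
either `r > sR`, whence `f(r/s) = 0`, or `r ≤ sR`, whence the Lipschitz bound gives
`f(r/s) ≤ f(r) + K r (1 - s⁻¹) ≤ f(r) + K s R (1 - s⁻¹)`. Summing over the pairs `i < j`
and integrating against `|Φ|²` (`lintegral_add_left`, `lintegral_const_mul'`) gives the claim.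
Folklore.
-/

noncomputable section

namespace Summit.AtomisticToContinuum.BoseEinsteinCondensation.Theorems.RigidMomentumBound

open MeasureTheory
open scoped ENNReal NNReal BigOperators
open Literature.MathematicalPhysics.QuantumManyBody.BoseGas

namespace EnergyScalePotential

variable {N : ℕ}

/-- Pointwise comparison of the profile at `r/s` with the profile at `r` (`s ≥ 1`, `r ≥ 0`):
`f(r/s) ≤ f(r) + K s R (1 - s⁻¹)` if `r ≤ sR` (Lipschitz bound, `|r/s - r| = r (1 - s⁻¹) ≤ sR (1 - s⁻¹)`),
and `f(r/s) = 0` if `r > sR` (finite range), in `ℝ≥0∞`. [folklore] -/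
theorem ofReal_apply_inv_mul_le {f : ℝ → ℝ} {K R : ℝ} (hK : 0 ≤ K)
    (hLip : ∀ r r' : ℝ, |f r - f r'| ≤ K * |r - r'|) (hsupp : ∀ r : ℝ, R ≤ r → f r = 0)
    {s : ℝ} (hs : 1 ≤ s) {r : ℝ} (hr : 0 ≤ r) :
    ENNReal.ofReal (f (s⁻¹ * r)) ≤
      ENNReal.ofReal (f r) +
        if r ≤ s * R then ENNReal.ofReal (K * s * R * (1 - s⁻¹)) else 0 := by
  have hs0 : 0 < s := one_pos.trans_le hs
  split_ifs with h
  · -- within the dilated range: Lipschitz bound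
    have h1 : s⁻¹ ≤ 1 := inv_le_one_of_one_le₀ hs
    have habs : |s⁻¹ * r - r| = r * (1 - s⁻¹) := by
      rw [abs_sub_comm, abs_of_nonneg (by nlinarith)]
      ring
    have hle : f (s⁻¹ * r) ≤ f r + K * s * R * (1 - s⁻¹) := by
      have h2 := hLip (s⁻¹ * r) r
      rw [habs] at h2
      have h3 : f (s⁻¹ * r) - f r ≤ K * (r * (1 - s⁻¹)) := (le_abs_self _).trans h2
      have h4 : K * (r * (1 - s⁻¹)) ≤ K * (s * R * (1 - s⁻¹)) :=
        mul_le_mul_of_nonneg_left (mul_le_mul_of_nonneg_right h (sub_nonneg.2 h1)) hK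
      linarith
    exact (ENNReal.ofReal_le_ofReal hle).trans ENNReal.ofReal_add_le
  · -- beyond the dilated range: the profile vanishes
    have hR : R ≤ s⁻¹ * r := by
      rw [le_inv_mul_iff₀ hs0]
      exact (not_le.1 h).le
    rw [hsupp _ hR, ENNReal.ofReal_zero, add_zero]
    exact bot_le

/-- The dilated potential is pointwise below the original one plus the constant
`K s R (1 - s⁻¹)` on `[0, sR]` (and below it outright beyond `sR`): `s⁻² ≤ 1` and
`ofReal_apply_inv_mul_le`. [folklore] -/
theorem scalePotential_ofReal_apply_le {f : ℝ → ℝ} {K R : ℝ} (hK : 0 ≤ K)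
    (hLip : ∀ r r' : ℝ, |f r - f r'| ≤ K * |r - r'|) (hsupp : ∀ r : ℝ, R ≤ r → f r = 0)
    {s : ℝ} (hs : 1 ≤ s) {r : ℝ} (hr : 0 ≤ r) :
    scalePotential s (fun r => ENNReal.ofReal (f r)) r ≤
      ENNReal.ofReal (f r) +
        if r ≤ s * R then ENNReal.ofReal (K * s * R * (1 - s⁻¹)) else 0 := by
  rw [scalePotential_apply]
  have h1 : ENNReal.ofReal (s ^ 2)⁻¹ ≤ 1 :=
    ENNReal.ofReal_le_one.2 (inv_le_one_of_one_le₀ (one_le_pow₀ hs))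
  calc ENNReal.ofReal (s ^ 2)⁻¹ * ENNReal.ofReal (f (s⁻¹ * r))
      ≤ 1 * ENNReal.ofReal (f (s⁻¹ * r)) := by gcongr
    _ = ENNReal.ofReal (f (s⁻¹ * r)) := one_mul _
    _ ≤ _ := ofReal_apply_inv_mul_le hK hLip hsupp hs hr

/-- Summing the indicator of `{dist ≤ sR}` times a constant over the pairs `i < j` gives the
constant times the number of pairs within distance `sR`. [folklore] -/
theorem sum_sum_ite_dist_le (X : Config N) (θ : ℝ≥0∞) (ℓ : ℝ) :
    ∑ i : Fin N, ∑ j : Fin N with i < j, (if dist (X i) (X j) ≤ ℓ then θ else 0) =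
      θ * (((Finset.univ.filter fun p : Fin N × Fin N =>
              p.1 < p.2 ∧ dist (X p.1) (X p.2) ≤ ℓ).card : ℕ) : ℝ≥0∞) := by
  rw [Finset.natCast_card_filter, Finset.mul_sum, Fintype.sum_prod_type]
  refine Finset.sum_congr rfl fun i _ => ?_
  rw [Finset.sum_filter]
  refine Finset.sum_congr rfl fun j _ => ?_
  dsimp only
  rw [ite_and]
  split_ifs <;> simp

/-- **Interaction comparison.** For every configuration `X`,
`∑_{i<j} v_s(|xᵢ - xⱼ|) ≤ ∑_{i<j} v(|xᵢ - xⱼ|) + K s R (1 - s⁻¹) · #{i < j : |xᵢ - xⱼ| ≤ sR}`.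
[folklore] -/
theorem interaction_scalePotential_ofReal_le {f : ℝ → ℝ} {K R : ℝ} (hK : 0 ≤ K)
    (hLip : ∀ r r' : ℝ, |f r - f r'| ≤ K * |r - r'|) (hsupp : ∀ r : ℝ, R ≤ r → f r = 0)
    {s : ℝ} (hs : 1 ≤ s) (X : Config N) :
    interaction (scalePotential s (fun r => ENNReal.ofReal (f r))) X ≤
      interaction (fun r => ENNReal.ofReal (f r)) X +
        ENNReal.ofReal (K * s * R * (1 - s⁻¹)) *
          (((Finset.univ.filter fun p : Fin N × Fin N =>
              p.1 < p.2 ∧ dist (X p.1) (X p.2) ≤ s * R).card : ℕ) : ℝ≥0∞) := by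
  rw [← sum_sum_ite_dist_le X _ (s * R)]
  calc interaction (scalePotential s fun r => ENNReal.ofReal (f r)) X
      ≤ ∑ i : Fin N, ∑ j : Fin N with i < j,
          (ENNReal.ofReal (f (dist (X i) (X j))) +
            if dist (X i) (X j) ≤ s * R then ENNReal.ofReal (K * s * R * (1 - s⁻¹)) else 0) :=
        Finset.sum_le_sum fun i _ => Finset.sum_le_sum fun j _ =>
          scalePotential_ofReal_apply_le hK hLip hsupp hs dist_nonneg
    _ = _ := by
        unfold interaction
        rw [← Finset.sum_add_distrib]
        refine Finset.sum_congr rfl fun i _ => ?_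
        rw [Finset.sum_add_distrib]

end EnergyScalePotential

/-- **`stub_energyScalePotentialLe`** (energy comparison under fattening of a Lipschitz
finite-range potential). For `f : ℝ → ℝ` `K`-Lipschitz (`K ≥ 0`) vanishing on `[R, ∞)` (`R > 0`),
`v = ofReal ∘ f`, `s ≥ 1` and every trial state `Φ` of `N` bosons in `Λ_L`:
`𝓔_{v_s}[Φ] ≤ 𝓔_v[Φ] + K s R (1 - s⁻¹) ∫ #{i < j : |xᵢ - xⱼ| ≤ sR} |Φ(X)|² dX`, where
`v_s = scalePotential s v`. The kinetic terms agree, the interaction terms compare pointwise by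
`interaction_scalePotential_ofReal_le`, and the integral splits by `lintegral_add_left`
(the `v`-energy density is measurable: `f` is Lipschitz, hence continuous) and
`lintegral_const_mul'`. [folklore] -/
theorem stub_energyScalePotentialLe :
    ∀ {N : ℕ} {L : ℝ} (f : ℝ → ℝ) (K R : ℝ), 0 ≤ K → 0 < R →
      (∀ r r' : ℝ, |f r - f r'| ≤ K * |r - r'|) → (∀ r : ℝ, R ≤ r → f r = 0) →
      ∀ (s : ℝ), 1 ≤ s → ∀ (Φ : TrialState N L),
        energy (scalePotential s (fun r => ENNReal.ofReal (f r))) Φ ≤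
          energy (fun r => ENNReal.ofReal (f r)) Φ +
            ENNReal.ofReal (K * s * R * (1 - s⁻¹)) *
              ∫⁻ X, (((Finset.univ.filter fun p : Fin N × Fin N =>
                p.1 < p.2 ∧ dist (X p.1) (X p.2) ≤ s * R).card : ℕ) : ℝ≥0∞) *
                  ((‖Φ.ψ X‖₊ : ℝ≥0∞)) ^ 2 := by
  intro N L f K R hK _hR hLip hsupp s hs Φ
  -- measurability of the `v`-energy density (`f` Lipschitz ⇒ continuous ⇒ `v` measurable)
  have hf : Continuous f := by
    have hL : LipschitzWith ⟨K, hK⟩ f := LipschitzWith.of_dist_le_mul fun x y => by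
      rw [Real.dist_eq, Real.dist_eq]
      exact hLip x y
    exact hL.continuous
  have hv : Measurable fun r => ENNReal.ofReal (f r) := hf.measurable.ennreal_ofReal
  have hmeas : Measurable fun X => kineticDensity Φ.ψ X +
      interaction (fun r => ENNReal.ofReal (f r)) X * ((‖Φ.ψ X‖₊ : ℝ≥0∞)) ^ 2 :=
    (measurable_kineticDensity Φ.contDiff).add
      ((measurable_interaction hv).mul (measurable_normSq Φ.contDiff.continuous))
  calc energy (scalePotential s (fun r => ENNReal.ofReal (f r))) Φ
      ≤ ∫⁻ X, (kineticDensity Φ.ψ X +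
            interaction (fun r => ENNReal.ofReal (f r)) X * ((‖Φ.ψ X‖₊ : ℝ≥0∞)) ^ 2) +
          ENNReal.ofReal (K * s * R * (1 - s⁻¹)) *
            ((((Finset.univ.filter fun p : Fin N × Fin N =>
                p.1 < p.2 ∧ dist (X p.1) (X p.2) ≤ s * R).card : ℕ) : ℝ≥0∞) *
              ((‖Φ.ψ X‖₊ : ℝ≥0∞)) ^ 2) := by
        refine lintegral_mono fun X => ?_
        calc kineticDensity Φ.ψ X +
              interaction (scalePotential s (fun r => ENNReal.ofReal (f r))) X *
                ((‖Φ.ψ X‖₊ : ℝ≥0∞)) ^ 2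
            ≤ kineticDensity Φ.ψ X +
              (interaction (fun r => ENNReal.ofReal (f r)) X +
                ENNReal.ofReal (K * s * R * (1 - s⁻¹)) *
                  (((Finset.univ.filter fun p : Fin N × Fin N =>
                      p.1 < p.2 ∧ dist (X p.1) (X p.2) ≤ s * R).card : ℕ) : ℝ≥0∞)) *
                ((‖Φ.ψ X‖₊ : ℝ≥0∞)) ^ 2 := by
              gcongr
              exact EnergyScalePotential.interaction_scalePotential_ofReal_le hK hLip hsupp hs X
          _ = _ := by ring
    _ = _ := by
        rw [lintegral_add_left hmeas, lintegral_const_mul' _ _ ENNReal.ofReal_ne_top]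
        rfl

end Summit.AtomisticToContinuum.BoseEinsteinCondensation.Theorems.RigidMomentumBound

end
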